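import Summits.QuantumFields.BalabanUV.Beta.EriceFlowEnclosureRecords
import Literature.MathematicalPhysics.QuantumFieldTheory.Balaban1983to89.T4ContinuumYM4Torus

/-!
# Beta / EriceFlowEnclosureT4 — where the Erice enclosure PLUGS INTO the honest headline: the print-faithful T⁴ twin
# `T4ContinuumYM4Torus.continuumYM4_torus_of_endpointExistence` with its β-binder `hEnd` DISCHARGED FROM the typed Erice
# records, for data whose coupling flow is generated forward by Erice's recursion (3.62)
# (β-flow team, prover 1, unit `b2b-balaban-beta-bflow-p1`; coordinator ruling e34b3e0c (1) «redirect towards the summit»)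

HONEST FRAMING (page 1 of everything the β sub-cell writes): discharging `BetaPertH` makes Bałaban's UV stability
UNCONDITIONAL — a real constructive-QFT result; it is NOT the continuum limit and NOT the Clay problem.  HONEST DEPENDENCY
(cell reorg 2026-08-19, verbatim): «continuum YM on T⁴ ⇐ BetaPertH ∧ nine spine estimates (0/9 proved); BetaPertH ⇐ (D1) ∧
(D4) ∧ CAP+tail; G-an2-4 gates asym, D1 and NE2/3/4.»  THIS MODULE DISCHARGES NOTHING OF BAŁABAN'S: it composes, BY NAME,
prover 1's `EriceFlowEnclosureRecords.endpointExistence_of_BJ86` with the tree's print-faithful headline.  What it makes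
kernel-explicit is the EXACT SENSE in which the dependency line's β-node can be read against print: for a printed-averaged
datum on `SU(N)` WHOSE COUPLING FLOW IS GENERATED FORWARD BY ERICE'S (3.62) through the dictionary `ofErice βE` (a MARKOV
family — gap (G4) of `Beta.EriceFlowEnclosure`: [Balaban1987RG1] p. 298 prints history dependence; whether Bałaban's
construction is of this kind is NOT asserted), the headline `ContinuumYM4Torus D` follows from (B) + the nine-estimate spine
slot + Erice's ASSERTED, UNPROVED sentences typed as records — (3.69) `Sandwich369` («for n sufficiently large»), the p. 249
sentence `UnifBoundedConvergent369` (boundedness half), «β regular» `Regular361` — and the one reading `]0, δ] ⊆ S`.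

ABSOLUTE RULE (cell charter, verbatim): "No internally-minted statement may enter as a cited fact. Every hypothesis is either
kernel-proved in this package or a verbatim quotation of a PUBLISHED theorem with page reference. The manuscript(s) under
audit are NOT citable for their own disputed steps — they are the thing under adjudication; programme-internal
(2001/route/tribunal) claims are never citable."  The Erice records are hypotheses («NOT asserted», their docstrings); (B)
(`B16.EndStatementBPrinted`) and the spine slot (`T4ApexHybrid.HybridNE7Under`, 0/9 estimates proved) are hypotheses.
NOT CLAIMED: that any hypothesis holds for Bałaban's data; continuum limit; Clay.  0 sorry; two one-line compositions.
-/

namespace Summit.QuantumFields.BalabanUV.Beta.EriceFlowEnclosureT4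

open Literature.MathematicalPhysics.QuantumFieldTheory.Balaban1983to89
open Literature.MathematicalPhysics.QuantumFieldTheory.Balaban1983to89.T4Continuum
open Literature.MathematicalPhysics.QuantumFieldTheory.Balaban1983to89.T4ContinuumYM4Torus
open Literature.MathematicalPhysics.QuantumFieldTheory.BalabanJaffe1986.BJ86CouplingRenormalization
  (UnifBoundedConvergent369 Sandwich369 Regular361)
open Summit.QuantumFields.BalabanUV.Beta.EriceFlowEnclosure (ofErice)
open Summit.QuantumFields.BalabanUV.Beta.EriceFlowEnclosureRecords (endpointExistence_of_BJ86)

variable {F : T4Family} {N : ℕ} [NeZero N]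

/-- **The print-faithful headline with its β-binder read against Erice.**  For a printed-averaged finite-ε datum `D` on `SU(N)`
with (B) (`B16.EndStatementBPrinted D.C`), whose construction's coupling flow is generated forward by Erice's (3.62) through
`ofErice βE` (`DagBinding.ForwardGenerated D.C.toB12 (ofErice βE)` — the Markov reading, gap (G4)), Erice's typed sentences
`Regular361 βE S`, `UnifBoundedConvergent369 βE βlim S`, `Sandwich369 βE S β″ β′ n₀` on a g²-set `S ⊇ ]0, δ]`, and the spine slot
`T4ApexHybrid.HybridNE7Under D (EndpointExistence D.C.toB12)`: `ContinuumYM4Torus D`.  (= the tree's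
`continuumYM4_torus_of_endpointExistence` with `hEnd := endpointExistence_of_BJ86 …`.)  Every binder is a hypothesis. -/
theorem continuumYM4_torus_of_BJ86 (D : FiniteEpsData F (Matrix.specialUnitaryGroup (Fin N) ℂ))
    (hD : D.IsPrintedAveraged) (hB : B16.EndStatementBPrinted D.C)
    (βE : ℕ → ℝ → ℝ) {βlim : ℝ → ℝ} {S : Set ℝ} {δ βlo βhi : ℝ} {n₀ : ℕ} (hδ : 0 < δ) (hS : Set.Ioc 0 δ ⊆ S)
    (hreg : Regular361 βE S) (hbc : UnifBoundedConvergent369 βE βlim S) (h369 : Sandwich369 βE S βlo βhi n₀)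
    (hgen : DagBinding.ForwardGenerated D.C.toB12 (ofErice βE))
    (hNE : T4ApexHybrid.HybridNE7Under D (DagBinding.EndpointExistence D.C.toB12)) : ContinuumYM4Torus D :=
  continuumYM4_torus_of_endpointExistence D hD hB (endpointExistence_of_BJ86 βE hδ hS hreg hbc h369 hgen) hNE

/-- The same with its non-vacuity clause (∀-form ∧ ∃-form: tuned bare-coupling sequences exist under the Erice-derived endpoint
existence), = the tree's `continuumYM4_torus_of_endpointExistence_nonvacuous` with `hEnd` from Erice. -/
theorem continuumYM4_torus_of_BJ86_nonvacuous (D : FiniteEpsData F (Matrix.specialUnitaryGroup (Fin N) ℂ))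
    (hD : D.IsPrintedAveraged) (hB : B16.EndStatementBPrinted D.C)
    (βE : ℕ → ℝ → ℝ) {βlim : ℝ → ℝ} {S : Set ℝ} {δ βlo βhi : ℝ} {n₀ : ℕ} (hδ : 0 < δ) (hS : Set.Ioc 0 δ ⊆ S)
    (hreg : Regular361 βE S) (hbc : UnifBoundedConvergent369 βE βlim S) (h369 : Sandwich369 βE S βlo βhi n₀)
    (hgen : DagBinding.ForwardGenerated D.C.toB12 (ofErice βE))
    (hNE : T4ApexHybrid.HybridNE7Under D (DagBinding.EndpointExistence D.C.toB12)) :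
    ContinuumYM4Torus D ∧ ContinuumYM4TorusE D :=
  continuumYM4_torus_of_endpointExistence_nonvacuous D hD hB (endpointExistence_of_BJ86 βE hδ hS hreg hbc h369 hgen) hNE

end Summit.QuantumFields.BalabanUV.Beta.EriceFlowEnclosureT4
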